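import Mathlib
import Summits.Ventures.PercRepro2.Defs
import Summits.Ventures.PercRepro2.Independence
import Summits.Ventures.PercRepro2.Harris
import Summits.Ventures.PercRepro2.Graph
import Summits.Ventures.PercRepro2.Events
import Summits.Ventures.PercRepro2.Induced
import Summits.Ventures.PercRepro2.CondAvoidPA
import Summits.Ventures.PercRepro2.MixedBoxDefs
import Summits.Ventures.PercRepro2.BHKAntitone
import Summits.Ventures.PercRepro2.BHKAntitoneCross
import Summits.Ventures.PercRepro2.ZFourFunctions

/-!
# The (Z)-four-functions inequality on the status grid — the lane's candidate (Z4F) in its own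
vocabulary (blind cell PercRepro2, mine-1 g51; paper proofs/MINE1-LSMPAIRS.md §9)

`ZFourFunctions.lean` proves the (Z)-four-functions inequality for functionals of the pair
`(C_s, C_t)`.  Here it is specialised to the three-status grid of `MixedBoxDefs`: for observed
vertices `u, v, w`, cell sets `S₁, S₂` that are UP-SETS of `Fin 3 × Fin 3 × Fin 3` in the product
order `T < N < S` (`0 < 1 < 2`), vertex sets `A₁, A₂ ∋ t` avoided by `s` and `B₁, B₂` avoided by `t`
(the lane's boxes: `boxEvent X Y = avoidEvent s (X.image ![u,v,w] ∪ {t}) ∩ avoidEvent t (Y.image ![u,v,w] ∪ {s})`):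

  (a) `P(σ ∈ S₁, s↮A₁, t↮B₁) · P(σ ∈ S₂, s↮A₂, t↮B₂)
          ≤ P(σ ∈ S₁∩S₂, s↮A₁∩A₂, t↮B₁∪B₂) · P(s↮A₁∪A₂)`            (`zfour_grid_s`)
  (b) for `s ∈ B₁, B₂`:
      `P(σ ∈ S₁, s↮A₁, t↮B₁) · P(σ ∈ S₂, s↮A₂, t↮B₂)
          ≤ P(s↮A₁∪A₂, t↮B₁∩B₂) · P(σ ∈ S₁∩S₂, t↮B₁∪B₂)`            (`zfour_grid_t`)

With `B₁ ∩ B₂ = {s}` in (a) and `A₁ ∩ A₂ = {t}` in (b) these are the two admissible shapes of the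
lane's (Z4F) (paper MINE1-UNIONROW-K3.md §15.9 (ii)); the excluded shape (both intersections
nonempty on the observed vertices) is false (§15.2).  The status triple is a (Z)-monotone function
of the pair of clusters (`stat_mono`), so the indicator of an up-set of cells, times the indicator
of a `t`-avoidance, is a (Z)-monotone functional (`gridFun_zmono`).
-/

namespace Summit.Ventures.PercRepro2

namespace ZFourGrid

open MixedBox

section Defs

variable {V : Type*}

open Classical in
/-- The status of `x` computed from a pair of vertex sets `(K, L)` (the clusters of `s` and `t`):
`2` if `x ∈ K`, else `0` if `x ∈ L`, else `1`. -/
noncomputable def stat (K L : Set V) (x : V) : Fin 3 :=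
  if x ∈ K then 2 else if x ∈ L then 0 else 1

/-- `stat` is increasing in `K` and decreasing in `L`. -/
lemma stat_mono {K K' L L' : Set V} (hK : K ⊆ K') (hL : L' ⊆ L) (x : V) :
    stat K L x ≤ stat K' L' x := by
  unfold stat
  by_cases hx : x ∈ K
  · rw [if_pos hx, if_pos (hK hx)]
  · rw [if_neg hx]
    by_cases hx' : x ∈ K'
    · rw [if_pos hx']
      split_ifs <;> decide
    · rw [if_neg hx']
      by_cases hl : x ∈ L
      · rw [if_pos hl]
        split_ifs <;> decide
      · rw [if_neg hl, if_neg (fun h => hl (hL h))]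

/-- The status triple of `(u, v, w)` from the pair `(K, L)`. -/
noncomputable def triple (K L : Set V) (u v w : V) : Fin 3 × Fin 3 × Fin 3 :=
  (stat K L u, stat K L v, stat K L w)

/-- The triple is (Z)-monotone. -/
lemma triple_mono {K K' L L' : Set V} (hK : K ⊆ K') (hL : L' ⊆ L) (u v w : V) :
    triple K L u v w ≤ triple K' L' u v w :=
  ⟨stat_mono hK hL u, stat_mono hK hL v, stat_mono hK hL w⟩

end Defs

section GridFunDefs

variable {V : Type*} {R : Type*} [CommRing R]

open Classical in
/-- The pair functional of an up-set `S` of cells and a `t`-avoided vertex set `B`: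
`1[triple(K, L) ∈ S] · 1[L ∩ B = ∅]`. -/
noncomputable def gridFun (S : Finset (Fin 3 × Fin 3 × Fin 3)) (u v w : V) (B : Finset V)
    (K L : Set V) : R :=
  (if triple K L u v w ∈ S then 1 else 0) * (if ∀ y ∈ B, y ∉ L then 1 else 0)

/-- `0 ≤ gridFun`. -/
lemma gridFun_nonneg [LinearOrder R] [IsStrictOrderedRing R]
    (S : Finset (Fin 3 × Fin 3 × Fin 3)) (u v w : V) (B : Finset V)
    (K L : Set V) : 0 ≤ (gridFun S u v w B K L : R) := by
  unfold gridFun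
  split_ifs <;> norm_num

/-- For an up-set `S` the functional is (Z)-monotone. -/
lemma gridFun_zmono [LinearOrder R] [IsStrictOrderedRing R] {S : Finset (Fin 3 × Fin 3 × Fin 3)}
    (hS : IsUpperSet (↑S : Set (Fin 3 × Fin 3 × Fin 3))) (u v w : V) (B : Finset V) :
    ∀ ⦃K K' L L' : Set V⦄, K ⊆ K' → L' ⊆ L →
      (gridFun S u v w B K L : R) ≤ gridFun S u v w B K' L' := by
  intro K K' L L' hK hL
  unfold gridFun
  have h1 : triple K L u v w ∈ S → triple K' L' u v w ∈ S := fun h =>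
    hS (triple_mono hK hL u v w) (Finset.mem_coe.2 h)
  have h2 : (∀ y ∈ B, y ∉ L) → ∀ y ∈ B, y ∉ L' := fun h y hy hy' => h y hy (hL hy')
  by_cases a : triple K L u v w ∈ S <;> by_cases b : ∀ y ∈ B, y ∉ L
  · rw [if_pos a, if_pos b, if_pos (h1 a), if_pos (h2 b)]
  · rw [if_pos a, if_neg b, if_pos (h1 a)]
    split_ifs <;> norm_num
  · rw [if_neg a, if_pos b]
    split_ifs <;> norm_num
  · rw [if_neg a, if_neg b]
    split_ifs <;> norm_num

/-- The product of two grid functionals is the grid functional of the intersection and the union. -/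
lemma gridFun_mul [DecidableEq V] (S₁ S₂ : Finset (Fin 3 × Fin 3 × Fin 3)) (u v w : V) (B₁ B₂ : Finset V)
    (K L : Set V) :
    (gridFun S₁ u v w B₁ K L : R) * gridFun S₂ u v w B₂ K L =
      gridFun (S₁ ∩ S₂) u v w (B₁ ∪ B₂) K L := by
  unfold gridFun
  have hu : (∀ y ∈ B₁ ∪ B₂, y ∉ L) ↔ (∀ y ∈ B₁, y ∉ L) ∧ (∀ y ∈ B₂, y ∉ L) :=
    Finset.forall_mem_union
  have hi : triple K L u v w ∈ S₁ ∩ S₂ ↔ triple K L u v w ∈ S₁ ∧ triple K L u v w ∈ S₂ :=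
    Finset.mem_inter
  by_cases b : ∀ y ∈ B₁ ∪ B₂, y ∉ L
  · obtain ⟨b1, b2⟩ := hu.1 b
    rw [if_pos b, if_pos b1, if_pos b2]
    by_cases a1 : triple K L u v w ∈ S₁ <;> by_cases a2 : triple K L u v w ∈ S₂
    · rw [if_pos a1, if_pos a2, if_pos (hi.2 ⟨a1, a2⟩)]
      ring
    · rw [if_pos a1, if_neg a2, if_neg (fun h => a2 (hi.1 h).2)]
      ring
    · rw [if_neg a1, if_pos a2, if_neg (fun h => a1 (hi.1 h).1)]
      ring
    · rw [if_neg a1, if_neg a2, if_neg (fun h => a1 (hi.1 h).1)]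
      ring
  · rw [if_neg b]
    by_cases b1 : ∀ y ∈ B₁, y ∉ L
    · have b2 : ¬ ∀ y ∈ B₂, y ∉ L := fun h => b (hu.2 ⟨b1, h⟩)
      rw [if_pos b1, if_neg b2]
      ring
    · rw [if_neg b1]
      ring

end GridFunDefs

section Main

variable {V : Type*} {E : Type*} [Fintype E] [DecidableEq E] [Fintype V] [DecidableEq V]
  {R : Type*} [CommRing R] [LinearOrder R] [IsStrictOrderedRing R]

omit [DecidableEq E] in
/-- On the clusters of `s` and `t`, `stat` is the status of `MixedBoxDefs`. -/
lemma stat_cluster (ends : E → Sym2 V) (s t x : V) (ω : Config E) :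
    stat (cluster ends ω s) (cluster ends ω t) x = status ends s t x ω := by
  unfold stat status
  by_cases h1 : Conn ends ω s x <;> by_cases h2 : Conn ends ω t x <;>
    simp [h1, h2, mem_cluster]

omit [DecidableEq E] [LinearOrder R] [IsStrictOrderedRing R] in
/-- On the clusters, the grid functional is the indicator of `{σ ∈ S} ∩ {t ↮ B}`. -/
lemma gridFun_cluster (ends : E → Sym2 V) (s t u v w : V) (S : Finset (Fin 3 × Fin 3 × Fin 3))
    (B : Finset V) (ω : Config E) :
    (gridFun S u v w B (cluster ends ω s) (cluster ends ω t) : R) =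
      (gridEvent ends s t u v w S ∩ avoidAll ends t B).indicator 1 ω := by
  unfold gridFun
  have e1 : triple (cluster ends ω s) (cluster ends ω t) u v w =
      (status ends s t u ω, status ends s t v ω, status ends s t w ω) := by
    unfold triple
    rw [stat_cluster, stat_cluster, stat_cluster]
  have e2 : (∀ y ∈ B, y ∉ cluster ends ω t) ↔ ω ∈ avoidAll ends t B := by
    simp only [mem_cluster, avoidAll, Set.mem_setOf_eq]
  rw [e1]
  by_cases a : (status ends s t u ω, status ends s t v ω, status ends s t w ω) ∈ S <;>
    by_cases b : ∀ y ∈ B, y ∉ cluster ends ω t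
  · rw [if_pos a, if_pos b, Set.indicator_of_mem (show ω ∈ gridEvent ends s t u v w S ∩
      avoidAll ends t B from ⟨a, e2.1 b⟩)]
    simp
  · rw [if_pos a, if_neg b, Set.indicator_of_notMem (show ω ∉ gridEvent ends s t u v w S ∩
      avoidAll ends t B from fun h => b (e2.2 h.2))]
    simp
  · rw [if_neg a, if_pos b, Set.indicator_of_notMem (show ω ∉ gridEvent ends s t u v w S ∩
      avoidAll ends t B from fun h => a h.1)]
    simp
  · rw [if_neg a, if_neg b, Set.indicator_of_notMem (show ω ∉ gridEvent ends s t u v w S ∩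
      avoidAll ends t B from fun h => a h.1)]
    simp

omit [LinearOrder R] [IsStrictOrderedRing R] in
/-- The expectation of a grid functional times an `s`-avoidance indicator is a probability. -/
lemma expect_gridFun_eq (p : E → R) (ends : E → Sym2 V) (s t u v w : V)
    (S : Finset (Fin 3 × Fin 3 × Fin 3)) (B A : Finset V) :
    expect p (fun ω => (gridFun S u v w B (cluster ends ω s) (cluster ends ω t) : R) *
        (avoidAll ends s A).indicator 1 ω) =
      prob p (gridEvent ends s t u v w S ∩ avoidAll ends t B ∩ avoidAll ends s A) := by
  rw [prob_eq_expect_indicator]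
  congr 1
  funext ω
  rw [gridFun_cluster, ← indicator_inter_one]

omit [LinearOrder R] [IsStrictOrderedRing R] in
/-- The same with `B = ∅` and two avoidance indicators (`s` and `t`). -/
lemma expect_gridFun_eq' (p : E → R) (ends : E → Sym2 V) (s t u v w : V)
    (S : Finset (Fin 3 × Fin 3 × Fin 3)) (A B : Finset V) :
    expect p (fun ω => (gridFun S u v w ∅ (cluster ends ω s) (cluster ends ω t) : R) *
        (avoidAll ends s A).indicator 1 ω * (avoidAll ends t B).indicator 1 ω) =
      prob p (gridEvent ends s t u v w S ∩ avoidAll ends s A ∩ avoidAll ends t B) := by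
  rw [prob_eq_expect_indicator]
  congr 1
  funext ω
  have e0 : avoidAll ends t (∅ : Finset V) = Set.univ := by
    ext ω'; simp [avoidAll]
  rw [gridFun_cluster, e0, Set.inter_univ, ← indicator_inter_one, ← indicator_inter_one]

omit [LinearOrder R] [IsStrictOrderedRing R] in
/-- The same with `B = ∅` and one `t`-avoidance indicator. -/
lemma expect_gridFun_eq'' (p : E → R) (ends : E → Sym2 V) (s t u v w : V)
    (S : Finset (Fin 3 × Fin 3 × Fin 3)) (B : Finset V) :
    expect p (fun ω => (gridFun S u v w ∅ (cluster ends ω s) (cluster ends ω t) : R) *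
        (avoidAll ends t B).indicator 1 ω) =
      prob p (gridEvent ends s t u v w S ∩ avoidAll ends t B) := by
  rw [prob_eq_expect_indicator]
  congr 1
  funext ω
  have e0 : avoidAll ends t (∅ : Finset V) = Set.univ := by
    ext ω'; simp [avoidAll]
  rw [gridFun_cluster, e0, Set.inter_univ, ← indicator_inter_one]

/-- **(Z4F) on the status grid, shape (a)** (two avoided sets of `s`; `t ∈ A₁, A₂`): for up-sets
`S₁, S₂` of cells and `t`-avoided sets `B₁, B₂`,
`P(σ ∈ S₁, t↮B₁, s↮A₁) · P(σ ∈ S₂, t↮B₂, s↮A₂) ≤ P(σ ∈ S₁∩S₂, t↮B₁∪B₂, s↮A₁∩A₂) · P(s↮A₁∪A₂)`. -/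
theorem zfour_grid_s (p : E → R) (hp : IsProbVec p) (ends : E → Sym2 V) (s t u v w : V)
    {A₁ A₂ : Finset V} (htA₁ : t ∈ A₁) (htA₂ : t ∈ A₂) (B₁ B₂ : Finset V)
    {S₁ S₂ : Finset (Fin 3 × Fin 3 × Fin 3)} (hS₁ : IsUpperSet (↑S₁ : Set (Fin 3 × Fin 3 × Fin 3)))
    (hS₂ : IsUpperSet (↑S₂ : Set (Fin 3 × Fin 3 × Fin 3))) :
    prob p (gridEvent ends s t u v w S₁ ∩ avoidAll ends t B₁ ∩ avoidAll ends s A₁) *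
        prob p (gridEvent ends s t u v w S₂ ∩ avoidAll ends t B₂ ∩ avoidAll ends s A₂) ≤
      prob p (gridEvent ends s t u v w (S₁ ∩ S₂) ∩ avoidAll ends t (B₁ ∪ B₂) ∩
          avoidAll ends s (A₁ ∩ A₂)) *
        prob p (avoidAll ends s (A₁ ∪ A₂)) := by
  have h := ZFour.zfour_s p hp ends s t htA₁ htA₂ (gridFun_zmono hS₁ u v w B₁)
    (gridFun_zmono hS₂ u v w B₂) (gridFun_nonneg S₁ u v w B₁)
    (gridFun_nonneg S₂ u v w B₂)
  have e3 : expect p (fun ω => (gridFun S₁ u v w B₁ (cluster ends ω s) (cluster ends ω t) : R) *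
      gridFun S₂ u v w B₂ (cluster ends ω s) (cluster ends ω t) *
      (avoidAll ends s (A₁ ∩ A₂)).indicator 1 ω) =
      prob p (gridEvent ends s t u v w (S₁ ∩ S₂) ∩ avoidAll ends t (B₁ ∪ B₂) ∩
        avoidAll ends s (A₁ ∩ A₂)) := by
    rw [← expect_gridFun_eq]
    congr 1
    funext ω
    rw [gridFun_mul]
  rw [expect_gridFun_eq, expect_gridFun_eq, e3] at h
  exact h

/-- **(Z4F) on the status grid, shape (b)** (two avoided sets of `t`; `s ∈ B₁, B₂`): for up-sets
`S₁, S₂` of cells and `s`-avoided sets `A₁, A₂`,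
`P(σ ∈ S₁, s↮A₁, t↮B₁) · P(σ ∈ S₂, s↮A₂, t↮B₂) ≤ P(s↮A₁∪A₂, t↮B₁∩B₂) · P(σ ∈ S₁∩S₂, t↮B₁∪B₂)`. -/
theorem zfour_grid_t (p : E → R) (hp : IsProbVec p) (ends : E → Sym2 V) (s t u v w : V)
    (A₁ A₂ : Finset V) {B₁ B₂ : Finset V} (hsB₁ : s ∈ B₁) (hsB₂ : s ∈ B₂)
    {S₁ S₂ : Finset (Fin 3 × Fin 3 × Fin 3)} (hS₁ : IsUpperSet (↑S₁ : Set (Fin 3 × Fin 3 × Fin 3)))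
    (hS₂ : IsUpperSet (↑S₂ : Set (Fin 3 × Fin 3 × Fin 3))) :
    prob p (gridEvent ends s t u v w S₁ ∩ avoidAll ends s A₁ ∩ avoidAll ends t B₁) *
        prob p (gridEvent ends s t u v w S₂ ∩ avoidAll ends s A₂ ∩ avoidAll ends t B₂) ≤
      prob p (avoidAll ends s (A₁ ∪ A₂) ∩ avoidAll ends t (B₁ ∩ B₂)) *
        prob p (gridEvent ends s t u v w (S₁ ∩ S₂) ∩ avoidAll ends t (B₁ ∪ B₂)) := by
  have h := ZFour.zfour_t p hp ends s t hsB₁ hsB₂ A₁ A₂ (gridFun_zmono hS₁ u v w ∅)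
    (gridFun_zmono hS₂ u v w ∅) (gridFun_nonneg S₁ u v w ∅)
    (gridFun_nonneg S₂ u v w ∅)
  have e4 : expect p (fun ω => (gridFun S₁ u v w ∅ (cluster ends ω s) (cluster ends ω t) : R) *
      gridFun S₂ u v w ∅ (cluster ends ω s) (cluster ends ω t) *
      (avoidAll ends t (B₁ ∪ B₂)).indicator 1 ω) =
      prob p (gridEvent ends s t u v w (S₁ ∩ S₂) ∩ avoidAll ends t (B₁ ∪ B₂)) := by
    rw [← expect_gridFun_eq'']
    congr 1
    funext ω
    rw [gridFun_mul, Finset.empty_union]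
  rw [expect_gridFun_eq', expect_gridFun_eq', e4] at h
  exact h

end Main

end ZFourGrid

end Summit.Ventures.PercRepro2
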